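import Summits.CriticalPhenomena.PercolationContinuityZ3.Theorems.PercNearOneGluingNoHeavyLowerTailHubPairApexMain
import Summits.CriticalPhenomena.PercolationContinuityZ3.Theorems.PercNearOneGluingNoHeavyLowerTailOneSumFreeGlue
import HarnessLib

/-!
# `NoHeavyLowerTail` (stmt-CriticalPhenomena-4575) — HUB PAIRS WITH THE APEX ALONE ON ITS SIDE, part 4:
# the reference functionals are the far side's own three-point cells; R1 from six FAR-SIDE rows (every `q > 0`)

Support file (prover prim-gen-kcluster gen 72; `--supports stmt-CriticalPhenomena-4575`).  No definitions, no named facts, no sorries.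
Notation of parts 1–3.  The reference blocks are pendant pairs at the hubs, so (for `η ⊆ DY`, `a` on no pair of `DY`):
* `mem_cl_pendant_off / _root`: `y ∈ cl ({ah} ∪ η) x ↔ y ∈ cl η x` off `a`, and `y ∈ cl ({ah} ∪ η) a ↔ y ∈ cl η h` (`OneSumFree.mem_cl_union_iff_right`);
  `mem_cl_two_pendant_root`: `y ∈ cl ({ah₁, ah₂} ∪ η) a ↔ y ∈ cl η h₁ ∨ y ∈ cl η h₂`;
* `sep_pendant`, `sep_two_pendant`: the reference support separation is `Sep DY (cl η h) b c`, resp. `Sep DY (cl η h₁ ∪ cl η h₂) b c`;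
* hence (`ref_C_eq`, `ref_D_eq`, `ref_A_eq`, one generic statement per state covering the four cells): `R_C(E)` = FREE mass of the far side's
  cell at apex `h₁`, `R_D(E)` = the same at apex `h₂`, `R_A(E)` = `{h₁,h₂}`-WIRED mass of the wired cell (`b ~ {h₁,h₂}`, …, `Sep DY (C(h₁) ∪ C(h₂)) b c`).
**THEOREM** (`HubPairApex.r1_of_far_side`, every `q > 0`): with `φ¹, φ²` the free measure `rcMeasureW wY q ∅` read at apex `h₁`, `h₂` and
`φ* = rcMeasureW wY q {h₁,h₂}` read on the wired cells, if R1 holds for `φ¹`, `φ²`, `φ*` and the three polar forms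
`X[φ*,φ¹], X[φ*,φ²]` (gen 65's `W⁰, W¹`) and `X[φ¹,φ²]` (gen 57's CROSS) are `≥ 0`, then R1 holds for `(a; b, c)` on the glued graph `DA ∪ DY`.
All six hypotheses concern the FAR SIDE ALONE; the first three are R1 instances (free at a hub; wired = free on the quotient by `{h₁,h₂}`),
`W⁰, W¹, CROSS` are census-true and open (KCLUSTER-gen57/65/66).  For the 1|1|1 split (`DY` = two terminal arms in parallel) all six follow
from R1 + FKG on the arms by gen 65's kernel certificates (`ThetaBlocks`).
-/

noncomputable section

namespace Summit.CriticalPhenomena.PercolationContinuityZ3.Theorems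

namespace HubPairApex

open Finset SimpleGraph Literature.Probability.Percolation Literature.Probability.Percolation.Gladkov
open Literature.Probability.Percolation.BHK2006 (weight)
open Literature.Probability.Percolation.DecisionTree (ind ind_of_mem ind_of_not_mem ind_nonneg)
open Literature.Probability.LatticeModels RefinedRowR3 ThreePointLB APL MeasureTheory
open scoped Classical

variable {V : Type*} [Fintype V]

/-! ### Pendant pairs -/

section Pendant

variable {ζ : Finset (Sym2 V)} {a h x y : V} (haζ : ∀ e ∈ ζ, a ∉ e) (hah : a ≠ h)
include haζ hah

omit hah in
/-- Off `a`, a pendant pair `ah` does not change clusters. [folklore] -/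
theorem mem_cl_pendant_off (hx : x ≠ a) (hy : y ≠ a) : y ∈ cl ({s(a, h)} ∪ ζ) x ↔ y ∈ cl ζ x := by
  refine OneSumFree.mem_cl_union_iff_right (u := h) ?_ ?_ ?_
  · rintro z ⟨e, he, hze⟩ ⟨f, hf, hzf⟩
    rw [Finset.mem_singleton] at he; subst he
    exact (Sym2.mem_iff.1 hze).elim (fun h' => absurd hzf (h' ▸ haζ f hf)) id
  · intro e he hxe; rw [Finset.mem_singleton] at he; subst he
    exact (Sym2.mem_iff.1 hxe).elim (fun h' => absurd h' hx) id
  · intro e he hye; rw [Finset.mem_singleton] at he; subst he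
    exact (Sym2.mem_iff.1 hye).elim (fun h' => absurd h' hy) id

/-- From `a`, a pendant pair `ah` reaches exactly the cluster of `h`. [folklore] -/
theorem mem_cl_pendant_root (hy : y ≠ a) : y ∈ cl ({s(a, h)} ∪ ζ) a ↔ y ∈ cl ζ h := by
  have hha : h ∈ cl ({s(a, h)} ∪ ζ) a := mem_cl_of_adj (mem_cl_self _ a)
    (by rw [openGraph_adj, Finset.mem_coe, Finset.mem_union, Finset.mem_singleton]; exact ⟨Or.inl rfl, hah⟩)
  rw [← mem_cl_pendant_off haζ (x := h) hah.symm hy]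
  exact ⟨fun h' => mem_cl_trans (mem_cl_comm.1 hha) h', fun h' => mem_cl_trans hha h'⟩

end Pendant

section TwoPendant

variable {ζ : Finset (Sym2 V)} {a h₁ h₂ y : V} (haζ : ∀ e ∈ ζ, a ∉ e) (ha1 : a ≠ h₁) (ha2 : a ≠ h₂)
include haζ ha1 ha2

/-- From `a`, two pendant pairs `ah₁, ah₂` reach exactly `C(h₁) ∪ C(h₂)`. [folklore] -/
theorem mem_cl_two_pendant_root (hy : y ≠ a) :
    y ∈ cl ({s(a, h₁), s(a, h₂)} ∪ ζ) a ↔ (y ∈ cl ζ h₁ ∨ y ∈ cl ζ h₂) := by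
  have hsplit : ({s(a, h₁), s(a, h₂)} : Finset (Sym2 V)) ∪ ζ = {s(a, h₁)} ∪ ({s(a, h₂)} ∪ ζ) := by
    rw [← Finset.union_assoc]; rfl
  rw [hsplit]
  have key := APL.series_ov_iff ({s(a, h₁)} : Finset (Sym2 V)) ({s(a, h₂)} ∪ ζ) a h₁ y ?_ ?_ hy
  · rw [key, mem_cl_pendant_root haζ ha2 hy, mem_cl_pendant_off haζ hy ha1.symm]
    have h1 : h₁ ∈ cl ({s(a, h₁)} : Finset (Sym2 V)) a := mem_cl_of_adj (mem_cl_self _ a)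
      (by rw [openGraph_adj, Finset.mem_coe, Finset.mem_singleton]; exact ⟨rfl, ha1⟩)
    constructor
    · rintro (h | ⟨h, -⟩)
      · exact Or.inr h
      · exact Or.inl (mem_cl_comm.1 h)
    · rintro (h | h)
      · exact Or.inr ⟨mem_cl_comm.1 h, Or.inr h1⟩
      · exact Or.inl h
  · rintro z ⟨e, he, hze⟩ ⟨f, hf, hzf⟩
    rw [Finset.mem_singleton] at he; subst he
    exact Sym2.mem_iff.1 hze
  · intro e he hye; rw [Finset.mem_singleton] at he; subst he
    exact (Sym2.mem_iff.1 hye).elim (fun h' => absurd h' hy) id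

end TwoPendant

/-! ### Reference support separation -/

section Sep

variable {DY ζ : Finset (Sym2 V)} {a h₁ h₂ b c : V} (ha1 : a ≠ h₁) (ha2 : a ≠ h₂) (haY : ∀ e ∈ DY, a ∉ e) (hζ : ζ ⊆ DY)
include ha1 ha2 haY hζ

omit ha1 ha2 haY hζ in
/-- Every reference pair touches `{a, h}` for a hub `h`. [folklore] -/
theorem ref_sdiff_touch_eq_empty {W : Finset V} (haW : a ∈ W) {h : V} (hh : h = h₁ ∨ h = h₂) (hhW : h ∈ W) :
    ({s(a, h₁), s(a, h₂), s(h₁, h₂)} : Finset (Sym2 V)) \ touch W = ∅ := by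
  refine Finset.eq_empty_of_forall_notMem fun e he => ?_
  rw [Finset.mem_sdiff, mem_touch] at he
  obtain ⟨he, hne⟩ := he
  simp only [Finset.mem_insert, Finset.mem_singleton] at he
  rcases he with rfl | rfl | rfl
  · exact hne ⟨a, haW, Sym2.mem_mk_left _ _⟩
  · exact hne ⟨a, haW, Sym2.mem_mk_left _ _⟩
  · rcases hh with rfl | rfl
    · exact hne ⟨_, hhW, Sym2.mem_mk_left _ _⟩
    · exact hne ⟨_, hhW, Sym2.mem_mk_right _ _⟩

/-- **Separation for one pendant pair**: `Sep (REF ∪ DY) (cl ({ah} ∪ ζ) a) b c ↔ Sep DY (cl ζ h) b c` (`h` a hub). [this work] -/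
theorem sep_pendant {h : V} (hh : h = h₁ ∨ h = h₂) :
    Sep ({s(a, h₁), s(a, h₂), s(h₁, h₂)} ∪ DY) (cl ({s(a, h)} ∪ ζ) a) b c ↔ Sep DY (cl ζ h) b c := by
  have hah : a ≠ h := by rcases hh with rfl | rfl <;> assumption
  have haζ : ∀ e ∈ ζ, a ∉ e := fun e he => haY e (hζ he)
  set W := cl ({s(a, h)} ∪ ζ) a with hW
  have haW : a ∈ W := mem_cl_self _ a
  have hhW : h ∈ W := (mem_cl_pendant_root haζ hah hah.symm).2 (mem_cl_self _ h)
  have hDY : DY \ touch W = DY \ touch (cl ζ h) := by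
    ext e
    simp only [Finset.mem_sdiff, mem_touch, not_exists, not_and]
    refine ⟨fun ⟨he, h1⟩ => ⟨he, fun z hz hze => h1 z ?_ hze⟩, fun ⟨he, h1⟩ => ⟨he, fun z hz hze => h1 z ?_ hze⟩⟩
    · exact (mem_cl_pendant_root haζ hah (fun h' => haY e he (h' ▸ hze))).2 hz
    · exact (mem_cl_pendant_root haζ hah (fun h' => haY e he (h' ▸ hze))).1 hz
  unfold RefinedRowR3.Sep
  rw [Finset.union_sdiff_distrib, ref_sdiff_touch_eq_empty haW hh hhW, Finset.empty_union, hDY]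

/-- **Separation for two pendant pairs**: `Sep (REF ∪ DY) (cl ({ah₁, ah₂} ∪ ζ) a) b c ↔ Sep DY (cl ζ h₁ ∪ cl ζ h₂) b c`. [this work] -/
theorem sep_two_pendant :
    Sep ({s(a, h₁), s(a, h₂), s(h₁, h₂)} ∪ DY) (cl ({s(a, h₁), s(a, h₂)} ∪ ζ) a) b c ↔ Sep DY (cl ζ h₁ ∪ cl ζ h₂) b c := by
  have haζ : ∀ e ∈ ζ, a ∉ e := fun e he => haY e (hζ he)
  set W := cl ({s(a, h₁), s(a, h₂)} ∪ ζ) a with hW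
  have haW : a ∈ W := mem_cl_self _ a
  have hhW : h₁ ∈ W := (mem_cl_two_pendant_root haζ ha1 ha2 ha1.symm).2 (Or.inl (mem_cl_self _ _))
  have hDY : DY \ touch W = DY \ touch (cl ζ h₁ ∪ cl ζ h₂) := by
    ext e
    simp only [Finset.mem_sdiff, mem_touch, not_exists, not_and, Finset.mem_union]
    refine ⟨fun ⟨he, h1⟩ => ⟨he, fun z hz hze => h1 z ?_ hze⟩, fun ⟨he, h1⟩ => ⟨he, fun z hz hze => h1 z ?_ hze⟩⟩
    · exact (mem_cl_two_pendant_root haζ ha1 ha2 (fun h' => haY e he (h' ▸ hze))).2 hz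
    · exact (mem_cl_two_pendant_root haζ ha1 ha2 (fun h' => haY e he (h' ▸ hze))).1 hz
  unfold RefinedRowR3.Sep
  rw [Finset.union_sdiff_distrib, ref_sdiff_touch_eq_empty haW (Or.inl rfl) hhW, Finset.empty_union, hDY]

end Sep

/-! ### The reference functionals are far-side masses -/

section Sums

variable {DA DY : Finset (Sym2 V)} {a h₁ h₂ b c : V} (h12 : h₁ ≠ h₂) (ha1 : a ≠ h₁) (ha2 : a ≠ h₂) (hab : a ≠ b) (hac : a ≠ c)
  (haY : ∀ e ∈ DY, a ∉ e)
  (w wY : Sym2 V → unitInterval) (q : ℝ) (hw : ∀ e, e ∉ (↑DA ∪ ↑DY : Set (Sym2 V)) → (w e : ℝ) = 0)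
  (hY : ∀ e ∈ (↑DA : Set (Sym2 V)), wY e = 0) (hY' : ∀ e ∉ (↑DA : Set (Sym2 V)), wY e = w e)

include hw hY hY' in
/-- Far-side sums only see configurations inside `DY`. [this work] -/
theorem sum_congr_DY (B : Set V) (F G : BondConfig V → ℝ) (hFG : ∀ η : BondConfig V, η ⊆ ↑DY → F η = G η) :
    ∑ η : BondConfig V, rcWeightW wY q B η * F η = ∑ η : BondConfig V, rcWeightW wY q B η * G η := by
  refine Finset.sum_congr rfl fun η _ => ?_
  by_cases hη : η ⊆ ↑DY
  · rw [hFG η hη]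
  · obtain ⟨e, heη, heY⟩ := Set.not_subset.1 hη
    have hwY : ∀ e', e' ∉ (↑DY : Set (Sym2 V)) → (wY e' : ℝ) = 0 := by
      intro e' he'
      by_cases heA : e' ∈ (↑DA : Set (Sym2 V))
      · rw [hY e' heA]; rfl
      · rw [hY' e' heA]; exact hw e' (fun h => h.elim heA he')
    have h0 := ApexTwoSum.weight_eq_zero_of_mem_not_mem wY hwY heη heY
    unfold rcWeightW
    rw [h0]; ring

include h12 in
/-- The free mass is the wired mass times `q^{[h₂ ∉ C(h₁)]}`. [this work] -/
theorem free_of_jf (F : BondConfig V → ℝ) :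
    ∑ η : BondConfig V, rcWeightW wY q ({h₁, h₂} : Set V) η * (F η * (if η ∈ {η : BondConfig V | h₂ ∈ cl η.toFinset h₁} then 1 else q)) =
      ∑ η : BondConfig V, rcWeightW wY q ∅ η * F η := by
  refine Finset.sum_congr rfl fun η _ => ?_
  unfold rcWeightW
  by_cases hJ : η ∈ {η : BondConfig V | h₂ ∈ cl η.toFinset h₁}
  · rw [if_pos hJ, ApexTwoSum.k_of_mem h12 η hJ]; ring
  · rw [if_neg hJ, ApexTwoSum.k_of_not_mem h12 η hJ, pow_succ]; ring

include ha1 ha2 hab hac haY in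
/-- **Cells of a pendant reference block** `{ah}` (`h` a hub), for `η ⊆ DY`: the glued-graph cells read at apex `a` are the far side's cells at apex `h`. [this work] -/
theorem pendant_cells {h : V} (hh : h = h₁ ∨ h = h₂) {η : BondConfig V} (hη : η ⊆ ↑DY) :
    ((({s(a, h)} : Set (Sym2 V)) ∪ η) ∈ {η : BondConfig V | b ∈ cl η.toFinset a ∧ c ∈ cl η.toFinset a} ↔ η ∈ {η : BondConfig V | b ∈ cl η.toFinset h ∧ c ∈ cl η.toFinset h}) ∧ ((({s(a, h)} : Set (Sym2 V)) ∪ η) ∈ {η : BondConfig V | b ∈ cl η.toFinset a ∧ c ∉ cl η.toFinset a} ↔ η ∈ {η : BondConfig V | b ∈ cl η.toFinset h ∧ c ∉ cl η.toFinset h}) ∧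
      ((({s(a, h)} : Set (Sym2 V)) ∪ η) ∈ {η : BondConfig V | b ∉ cl η.toFinset a ∧ c ∈ cl η.toFinset a} ↔ η ∈ {η : BondConfig V | b ∉ cl η.toFinset h ∧ c ∈ cl η.toFinset h}) ∧ ((({s(a, h)} : Set (Sym2 V)) ∪ η) ∈ {η : BondConfig V | b ∉ cl η.toFinset a ∧ c ∉ cl η.toFinset a ∧ Sep (({s(a, h₁), s(a, h₂), s(h₁, h₂)} : Finset (Sym2 V)) ∪ DY) (cl η.toFinset a) b c} ↔ η ∈ {η : BondConfig V | b ∉ cl η.toFinset h ∧ c ∉ cl η.toFinset h ∧ Sep DY (cl η.toFinset h) b c}) := by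
  have hah : a ≠ h := by rcases hh with rfl | rfl <;> assumption
  simp only [Set.mem_setOf_eq]
  suffices key : ∀ ζ ζ₁ : Finset (Sym2 V), (∀ e, e ∈ ζ ↔ e ∈ (({s(a, h)} : Set (Sym2 V)) ∪ η)) → (∀ e, e ∈ ζ₁ ↔ e ∈ η) →
      (((b ∈ cl ζ a ∧ c ∈ cl ζ a) ↔ (b ∈ cl ζ₁ h ∧ c ∈ cl ζ₁ h)) ∧ ((b ∈ cl ζ a ∧ c ∉ cl ζ a) ↔ (b ∈ cl ζ₁ h ∧ c ∉ cl ζ₁ h)) ∧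
        ((b ∉ cl ζ a ∧ c ∈ cl ζ a) ↔ (b ∉ cl ζ₁ h ∧ c ∈ cl ζ₁ h)) ∧
        ((b ∉ cl ζ a ∧ c ∉ cl ζ a ∧ Sep (({s(a, h₁), s(a, h₂), s(h₁, h₂)} : Finset (Sym2 V)) ∪ DY) (cl ζ a) b c) ↔ (b ∉ cl ζ₁ h ∧ c ∉ cl ζ₁ h ∧ Sep DY (cl ζ₁ h) b c))) from
    key _ _ (fun e => by simp only [Set.mem_toFinset]) (fun e => by simp only [Set.mem_toFinset])
  intro ζ ζ₁ hζ hζ₁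
  suffices h3 : (b ∈ cl ζ a ↔ b ∈ cl ζ₁ h) ∧ (c ∈ cl ζ a ↔ c ∈ cl ζ₁ h) ∧ (Sep (({s(a, h₁), s(a, h₂), s(h₁, h₂)} : Finset (Sym2 V)) ∪ DY) (cl ζ a) b c ↔ Sep DY (cl ζ₁ h) b c) by
    obtain ⟨eb, ec, es⟩ := h3
    rw [eb, ec, es]
    exact ⟨Iff.rfl, Iff.rfl, Iff.rfl, Iff.rfl⟩
  have hζ₁Y : ζ₁ ⊆ DY := fun e he => Finset.mem_coe.1 (hη ((hζ₁ e).1 he))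
  have haζ₁ : ∀ e ∈ ζ₁, a ∉ e := fun e he => haY e (hζ₁Y he)
  have hζ' : ζ = {s(a, h)} ∪ ζ₁ := by
    ext e; rw [hζ, Finset.mem_union, Finset.mem_singleton, hζ₁, Set.mem_union, Set.mem_singleton_iff]
  rw [hζ']
  exact ⟨mem_cl_pendant_root haζ₁ hah hab.symm, mem_cl_pendant_root haζ₁ hah hac.symm, sep_pendant ha1 ha2 haY hζ₁Y hh⟩

include ha1 ha2 hab hac haY in
/-- **Cells of the two-pendant reference block** `{ah₁, ah₂}`, for `η ⊆ DY`: the glued-graph cells read at apex `a` are the far side's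
`{h₁,h₂}`-WIRED cells. [this work] -/
theorem two_pendant_cells {η : BondConfig V} (hη : η ⊆ ↑DY) :
    ((({s(a, h₁), s(a, h₂)} : Set (Sym2 V)) ∪ η) ∈ {η : BondConfig V | b ∈ cl η.toFinset a ∧ c ∈ cl η.toFinset a} ↔ η ∈ {η : BondConfig V | (b ∈ cl η.toFinset h₁ ∨ b ∈ cl η.toFinset h₂) ∧ (c ∈ cl η.toFinset h₁ ∨ c ∈ cl η.toFinset h₂)}) ∧ ((({s(a, h₁), s(a, h₂)} : Set (Sym2 V)) ∪ η) ∈ {η : BondConfig V | b ∈ cl η.toFinset a ∧ c ∉ cl η.toFinset a} ↔ η ∈ {η : BondConfig V | (b ∈ cl η.toFinset h₁ ∨ b ∈ cl η.toFinset h₂) ∧ ¬ (c ∈ cl η.toFinset h₁ ∨ c ∈ cl η.toFinset h₂)}) ∧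
      ((({s(a, h₁), s(a, h₂)} : Set (Sym2 V)) ∪ η) ∈ {η : BondConfig V | b ∉ cl η.toFinset a ∧ c ∈ cl η.toFinset a} ↔ η ∈ {η : BondConfig V | ¬ (b ∈ cl η.toFinset h₁ ∨ b ∈ cl η.toFinset h₂) ∧ (c ∈ cl η.toFinset h₁ ∨ c ∈ cl η.toFinset h₂)}) ∧ ((({s(a, h₁), s(a, h₂)} : Set (Sym2 V)) ∪ η) ∈ {η : BondConfig V | b ∉ cl η.toFinset a ∧ c ∉ cl η.toFinset a ∧ Sep (({s(a, h₁), s(a, h₂), s(h₁, h₂)} : Finset (Sym2 V)) ∪ DY) (cl η.toFinset a) b c} ↔ η ∈ {η : BondConfig V | ¬ (b ∈ cl η.toFinset h₁ ∨ b ∈ cl η.toFinset h₂) ∧ ¬ (c ∈ cl η.toFinset h₁ ∨ c ∈ cl η.toFinset h₂) ∧ Sep DY (cl η.toFinset h₁ ∪ cl η.toFinset h₂) b c}) := by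
  simp only [Set.mem_setOf_eq]
  suffices key : ∀ ζ ζ₁ : Finset (Sym2 V), (∀ e, e ∈ ζ ↔ e ∈ (({s(a, h₁), s(a, h₂)} : Set (Sym2 V)) ∪ η)) → (∀ e, e ∈ ζ₁ ↔ e ∈ η) →
      (((b ∈ cl ζ a ∧ c ∈ cl ζ a) ↔ ((b ∈ cl ζ₁ h₁ ∨ b ∈ cl ζ₁ h₂) ∧ (c ∈ cl ζ₁ h₁ ∨ c ∈ cl ζ₁ h₂))) ∧
        ((b ∈ cl ζ a ∧ c ∉ cl ζ a) ↔ ((b ∈ cl ζ₁ h₁ ∨ b ∈ cl ζ₁ h₂) ∧ ¬ (c ∈ cl ζ₁ h₁ ∨ c ∈ cl ζ₁ h₂))) ∧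
        ((b ∉ cl ζ a ∧ c ∈ cl ζ a) ↔ (¬ (b ∈ cl ζ₁ h₁ ∨ b ∈ cl ζ₁ h₂) ∧ (c ∈ cl ζ₁ h₁ ∨ c ∈ cl ζ₁ h₂))) ∧
        ((b ∉ cl ζ a ∧ c ∉ cl ζ a ∧ Sep (({s(a, h₁), s(a, h₂), s(h₁, h₂)} : Finset (Sym2 V)) ∪ DY) (cl ζ a) b c) ↔
          (¬ (b ∈ cl ζ₁ h₁ ∨ b ∈ cl ζ₁ h₂) ∧ ¬ (c ∈ cl ζ₁ h₁ ∨ c ∈ cl ζ₁ h₂) ∧ Sep DY (cl ζ₁ h₁ ∪ cl ζ₁ h₂) b c))) from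
    key _ _ (fun e => by simp only [Set.mem_toFinset]) (fun e => by simp only [Set.mem_toFinset])
  intro ζ ζ₁ hζ hζ₁
  suffices h3 : (b ∈ cl ζ a ↔ (b ∈ cl ζ₁ h₁ ∨ b ∈ cl ζ₁ h₂)) ∧ (c ∈ cl ζ a ↔ (c ∈ cl ζ₁ h₁ ∨ c ∈ cl ζ₁ h₂)) ∧
      (Sep (({s(a, h₁), s(a, h₂), s(h₁, h₂)} : Finset (Sym2 V)) ∪ DY) (cl ζ a) b c ↔ Sep DY (cl ζ₁ h₁ ∪ cl ζ₁ h₂) b c) by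
    obtain ⟨eb, ec, es⟩ := h3
    rw [eb, ec, es]
    exact ⟨Iff.rfl, Iff.rfl, Iff.rfl, Iff.rfl⟩
  have hζ₁Y : ζ₁ ⊆ DY := fun e he => Finset.mem_coe.1 (hη ((hζ₁ e).1 he))
  have haζ₁ : ∀ e ∈ ζ₁, a ∉ e := fun e he => haY e (hζ₁Y he)
  have hζ' : ζ = {s(a, h₁), s(a, h₂)} ∪ ζ₁ := by
    ext e
    rw [hζ, Finset.mem_union, Finset.mem_insert, Finset.mem_singleton, hζ₁, Set.mem_union, Set.mem_insert_iff,
      Set.mem_singleton_iff]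
  rw [hζ']
  exact ⟨mem_cl_two_pendant_root haζ₁ ha1 ha2 hab.symm, mem_cl_two_pendant_root haζ₁ ha1 ha2 hac.symm,
    sep_two_pendant ha1 ha2 haY hζ₁Y⟩

include h12 hw hY hY' in
/-- **A pendant row is a free far-side mass.** [this work] -/
theorem ref_sum_pendant {h : V} {E Eh : Set (BondConfig V)}
    (hE : ∀ η : BondConfig V, η ⊆ ↑DY → ((({s(a, h)} : Set (Sym2 V)) ∪ η) ∈ E ↔ η ∈ Eh)) :
    ∑ η : BondConfig V, rcWeightW wY q ({h₁, h₂} : Set V) η * (ind {η : BondConfig V | (({s(a, h)} : Set (Sym2 V)) ∪ η) ∈ E} η * (if η ∈ {η : BondConfig V | h₂ ∈ cl η.toFinset h₁} then 1 else q)) =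
      ∑ η : BondConfig V, rcWeightW wY q ∅ η * ind Eh η := by
  rw [← free_of_jf h12 wY q]
  refine sum_congr_DY w wY q hw hY hY' ({h₁, h₂} : Set V) _ _ fun η hη => ?_
  by_cases hm : η ∈ Eh
  · have h1 : η ∈ {η : BondConfig V | (({s(a, h)} : Set (Sym2 V)) ∪ η) ∈ E} := (hE η hη).2 hm
    rw [ind_of_mem h1, ind_of_mem hm]
  · have h1 : η ∉ {η : BondConfig V | (({s(a, h)} : Set (Sym2 V)) ∪ η) ∈ E} := fun h' => hm ((hE η hη).1 h')
    rw [ind_of_not_mem h1, ind_of_not_mem hm]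

include hw hY hY' in
/-- **The two-pendant row is a wired far-side mass.** [this work] -/
theorem ref_sum_two_pendant {E Ew : Set (BondConfig V)} (hE : ∀ η : BondConfig V, η ⊆ ↑DY → ((({s(a, h₁), s(a, h₂)} : Set (Sym2 V)) ∪ η) ∈ E ↔ η ∈ Ew)) :
    ∑ η : BondConfig V, rcWeightW wY q ({h₁, h₂} : Set V) η * ind {η : BondConfig V | (({s(a, h₁), s(a, h₂)} : Set (Sym2 V)) ∪ η) ∈ E} η =
      ∑ η : BondConfig V, rcWeightW wY q ({h₁, h₂} : Set V) η * ind Ew η := by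
  refine sum_congr_DY w wY q hw hY hY' ({h₁, h₂} : Set V) _ _ fun η hη => ?_
  by_cases hm : η ∈ Ew
  · have h1 : η ∈ {η : BondConfig V | (({s(a, h₁), s(a, h₂)} : Set (Sym2 V)) ∪ η) ∈ E} := (hE η hη).2 hm
    rw [ind_of_mem h1, ind_of_mem hm]
  · have h1 : η ∉ {η : BondConfig V | (({s(a, h₁), s(a, h₂)} : Set (Sym2 V)) ∪ η) ∈ E} := fun h' => hm ((hE η hη).1 h')
    rw [ind_of_not_mem h1, ind_of_not_mem hm]

end Sums

/-! ### R1 from six far-side rows -/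

section Main

omit [Fintype V] in
/-- Clearing one partition function from an R1-type row. [folklore] -/
theorem sq_of_div {Z x y u v : ℝ} (hZ : 0 < Z) (h : x / Z * (y / Z) ≤ u / Z * (v / Z)) : x * y ≤ u * v := by
  rw [div_mul_div_comm, div_mul_div_comm, div_le_div_iff_of_pos_right (mul_pos hZ hZ)] at h
  exact h

omit [Fintype V] in
/-- Clearing two partition functions from a polar row. [folklore] -/
theorem polar_of_div {Z₁ Z₂ x y x' y' u v u' v' : ℝ} (h1 : 0 < Z₁) (h2 : 0 < Z₂)
    (h : x / Z₁ * (y / Z₂) + x' / Z₂ * (y' / Z₁) ≤ u / Z₁ * (v / Z₂) + u' / Z₂ * (v' / Z₁)) :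
    x * y + x' * y' ≤ u * v + u' * v' := by
  rw [div_mul_div_comm, div_mul_div_comm, div_mul_div_comm, div_mul_div_comm, mul_comm Z₂ Z₁, ← add_div, ← add_div,
    div_le_div_iff_of_pos_right (mul_pos h1 h2)] at h
  exact h

variable {DA DY D : Finset (Sym2 V)} {a h₁ h₂ b c : V} (h12 : h₁ ≠ h₂) (ha1 : a ≠ h₁) (ha2 : a ≠ h₂) (hab : a ≠ b) (hac : a ≠ c)
  (hsepD : ∀ z : V, (∃ e ∈ DA, z ∈ e) → (∃ e ∈ DY, z ∈ e) → (z = h₁ ∨ z = h₂)) (haY : ∀ e ∈ DY, a ∉ e)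
  (hb : ∀ e ∈ DA, b ∈ e → (b = h₁ ∨ b = h₂)) (hc : ∀ e ∈ DA, c ∈ e → (c = h₁ ∨ c = h₂)) (hbc : c ∈ cl DY b)
  (hD : ∀ e, e ∈ D ↔ e ∈ DA ∨ e ∈ DY)
  (w wA wY : Sym2 V → unitInterval) {q : ℝ} (hq : 0 < q)
  (hw : ∀ e, e ∉ (↑DA ∪ ↑DY : Set (Sym2 V)) → (w e : ℝ) = 0)
  (hX : ∀ e ∈ (↑DA : Set (Sym2 V)), wA e = w e) (hX' : ∀ e ∉ (↑DA : Set (Sym2 V)), wA e = 0)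
  (hY : ∀ e ∈ (↑DA : Set (Sym2 V)), wY e = 0) (hY' : ∀ e ∉ (↑DA : Set (Sym2 V)), wY e = w e)
include h12 ha1 ha2 hab hac hsepD haY hb hc hbc hD hq hw hX hX' hY hY'

/-- **R1 across a hub pair isolating the apex, from six rows of the far side alone** (every `q > 0`): R1 for the far side's free
measure at apex `h₁` and at apex `h₂`, R1 for its `{h₁,h₂}`-wired measure, the two free–wired polar rows `W⁰, W¹` and the apex cross row
`CROSS` imply R1 for `(a; b, c)` on the glued graph (support `D = DA ∪ DY`). [this work] -/
theorem r1_of_far_side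
    (hR1 : (rcMeasureW wY q ∅).real {η : BondConfig V | b ∈ cl η.toFinset h₁ ∧ c ∈ cl η.toFinset h₁} * (rcMeasureW wY q ∅).real {η : BondConfig V | b ∉ cl η.toFinset h₁ ∧ c ∉ cl η.toFinset h₁ ∧ Sep DY (cl η.toFinset h₁) b c} ≤ (rcMeasureW wY q ∅).real {η : BondConfig V | b ∈ cl η.toFinset h₁ ∧ c ∉ cl η.toFinset h₁} * (rcMeasureW wY q ∅).real {η : BondConfig V | b ∉ cl η.toFinset h₁ ∧ c ∈ cl η.toFinset h₁})
    (hR2 : (rcMeasureW wY q ∅).real {η : BondConfig V | b ∈ cl η.toFinset h₂ ∧ c ∈ cl η.toFinset h₂} * (rcMeasureW wY q ∅).real {η : BondConfig V | b ∉ cl η.toFinset h₂ ∧ c ∉ cl η.toFinset h₂ ∧ Sep DY (cl η.toFinset h₂) b c} ≤ (rcMeasureW wY q ∅).real {η : BondConfig V | b ∈ cl η.toFinset h₂ ∧ c ∉ cl η.toFinset h₂} * (rcMeasureW wY q ∅).real {η : BondConfig V | b ∉ cl η.toFinset h₂ ∧ c ∈ cl η.toFinset h₂})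
    (hRw : (rcMeasureW wY q ({h₁, h₂} : Set V)).real {η : BondConfig V | (b ∈ cl η.toFinset h₁ ∨ b ∈ cl η.toFinset h₂) ∧ (c ∈ cl η.toFinset h₁ ∨ c ∈ cl η.toFinset h₂)} * (rcMeasureW wY q ({h₁, h₂} : Set V)).real {η : BondConfig V | ¬ (b ∈ cl η.toFinset h₁ ∨ b ∈ cl η.toFinset h₂) ∧ ¬ (c ∈ cl η.toFinset h₁ ∨ c ∈ cl η.toFinset h₂) ∧ Sep DY (cl η.toFinset h₁ ∪ cl η.toFinset h₂) b c} ≤ (rcMeasureW wY q ({h₁, h₂} : Set V)).real {η : BondConfig V | (b ∈ cl η.toFinset h₁ ∨ b ∈ cl η.toFinset h₂) ∧ ¬ (c ∈ cl η.toFinset h₁ ∨ c ∈ cl η.toFinset h₂)} * (rcMeasureW wY q ({h₁, h₂} : Set V)).real {η : BondConfig V | ¬ (b ∈ cl η.toFinset h₁ ∨ b ∈ cl η.toFinset h₂) ∧ (c ∈ cl η.toFinset h₁ ∨ c ∈ cl η.toFinset h₂)})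
    (hW0 : (rcMeasureW wY q ({h₁, h₂} : Set V)).real {η : BondConfig V | (b ∈ cl η.toFinset h₁ ∨ b ∈ cl η.toFinset h₂) ∧ (c ∈ cl η.toFinset h₁ ∨ c ∈ cl η.toFinset h₂)} * (rcMeasureW wY q ∅).real {η : BondConfig V | b ∉ cl η.toFinset h₁ ∧ c ∉ cl η.toFinset h₁ ∧ Sep DY (cl η.toFinset h₁) b c} + (rcMeasureW wY q ∅).real {η : BondConfig V | b ∈ cl η.toFinset h₁ ∧ c ∈ cl η.toFinset h₁} * (rcMeasureW wY q ({h₁, h₂} : Set V)).real {η : BondConfig V | ¬ (b ∈ cl η.toFinset h₁ ∨ b ∈ cl η.toFinset h₂) ∧ ¬ (c ∈ cl η.toFinset h₁ ∨ c ∈ cl η.toFinset h₂) ∧ Sep DY (cl η.toFinset h₁ ∪ cl η.toFinset h₂) b c} ≤ (rcMeasureW wY q ({h₁, h₂} : Set V)).real {η : BondConfig V | (b ∈ cl η.toFinset h₁ ∨ b ∈ cl η.toFinset h₂) ∧ ¬ (c ∈ cl η.toFinset h₁ ∨ c ∈ cl η.toFinset h₂)} * (rcMeasureW wY q ∅).real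 {η : BondConfig V | b ∉ cl η.toFinset h₁ ∧ c ∈ cl η.toFinset h₁} + (rcMeasureW wY q ∅).real {η : BondConfig V | b ∈ cl η.toFinset h₁ ∧ c ∉ cl η.toFinset h₁} * (rcMeasureW wY q ({h₁, h₂} : Set V)).real {η : BondConfig V | ¬ (b ∈ cl η.toFinset h₁ ∨ b ∈ cl η.toFinset h₂) ∧ (c ∈ cl η.toFinset h₁ ∨ c ∈ cl η.toFinset h₂)})
    (hW1 : (rcMeasureW wY q ({h₁, h₂} : Set V)).real {η : BondConfig V | (b ∈ cl η.toFinset h₁ ∨ b ∈ cl η.toFinset h₂) ∧ (c ∈ cl η.toFinset h₁ ∨ c ∈ cl η.toFinset h₂)} * (rcMeasureW wY q ∅).real {η : BondConfig V | b ∉ cl η.toFinset h₂ ∧ c ∉ cl η.toFinset h₂ ∧ Sep DY (cl η.toFinset h₂) b c} + (rcMeasureW wY q ∅).real {η : BondConfig V | b ∈ cl η.toFinset h₂ ∧ c ∈ cl η.toFinset h₂} * (rcMeasureW wY q ({h₁, h₂} : Set V)).real {η : BondConfig V | ¬ (b ∈ cl η.toFinset h₁ ∨ b ∈ cl η.toFinset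 h₂) ∧ ¬ (c ∈ cl η.toFinset h₁ ∨ c ∈ cl η.toFinset h₂) ∧ Sep DY (cl η.toFinset h₁ ∪ cl η.toFinset h₂) b c} ≤ (rcMeasureW wY q ({h₁, h₂} : Set V)).real {η : BondConfig V | (b ∈ cl η.toFinset h₁ ∨ b ∈ cl η.toFinset h₂) ∧ ¬ (c ∈ cl η.toFinset h₁ ∨ c ∈ cl η.toFinset h₂)} * (rcMeasureW wY q ∅).real {η : BondConfig V | b ∉ cl η.toFinset h₂ ∧ c ∈ cl η.toFinset h₂} + (rcMeasureW wY q ∅).real {η : BondConfig V | b ∈ cl η.toFinset h₂ ∧ c ∉ cl η.toFinset h₂} * (rcMeasureW wY q ({h₁, h₂} : Set V)).real {η : BondConfig V | ¬ (b ∈ cl η.toFinset h₁ ∨ b ∈ cl η.toFinset h₂) ∧ (c ∈ cl η.toFinset h₁ ∨ c ∈ cl η.toFinset h₂)})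
    (hCR : (rcMeasureW wY q ∅).real {η : BondConfig V | b ∈ cl η.toFinset h₁ ∧ c ∈ cl η.toFinset h₁} * (rcMeasureW wY q ∅).real {η : BondConfig V | b ∉ cl η.toFinset h₂ ∧ c ∉ cl η.toFinset h₂ ∧ Sep DY (cl η.toFinset h₂) b c} + (rcMeasureW wY q ∅).real {η : BondConfig V | b ∈ cl η.toFinset h₂ ∧ c ∈ cl η.toFinset h₂} * (rcMeasureW wY q ∅).real {η : BondConfig V | b ∉ cl η.toFinset h₁ ∧ c ∉ cl η.toFinset h₁ ∧ Sep DY (cl η.toFinset h₁) b c} ≤ (rcMeasureW wY q ∅).real {η : BondConfig V | b ∈ cl η.toFinset h₁ ∧ c ∉ cl η.toFinset h₁} * (rcMeasureW wY q ∅).real {η : BondConfig V | b ∉ cl η.toFinset h₂ ∧ c ∈ cl η.toFinset h₂} + (rcMeasureW wY q ∅).real {η : BondConfig V | b ∈ cl η.toFinset h₂ ∧ c ∉ cl η.toFinset h₂} * (rcMeasureW wY q ∅).real {η : BondConfig V | b ∉ cl η.toFinset h₁ ∧ c ∈ cl η.toFinset h₁}) :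
    (rcMeasureW w q ∅).real {η : BondConfig V | b ∈ cl η.toFinset a ∧ c ∈ cl η.toFinset a} * (rcMeasureW w q ∅).real {η : BondConfig V | b ∉ cl η.toFinset a ∧ c ∉ cl η.toFinset a ∧ Sep D (cl η.toFinset a) b c} ≤ (rcMeasureW w q ∅).real {η : BondConfig V | b ∈ cl η.toFinset a ∧ c ∉ cl η.toFinset a} * (rcMeasureW w q ∅).real {η : BondConfig V | b ∉ cl η.toFinset a ∧ c ∈ cl η.toFinset a} := by
  have hZf := rcPartitionFunctionW_pos wY hq (∅ : Set V)
  have hZw := rcPartitionFunctionW_pos wY hq ({h₁, h₂} : Set V)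
  simp only [rcMeasureW_real_eq_sum_div wY hq] at hR1 hR2 hRw hW0 hW1 hCR
  have mR1 := sq_of_div hZf hR1
  have mR2 := sq_of_div hZf hR2
  have mRw := sq_of_div hZw hRw
  have mW0 := polar_of_div hZw hZf hW0
  have mW1 := polar_of_div hZw hZf hW1
  have mCR := polar_of_div hZf hZf hCR
  -- identification of the reference functionals
  have pc1 := fun (η : BondConfig V) (hη : η ⊆ (↑DY : Set (Sym2 V))) => pendant_cells (DY := DY) (b := b) (c := c) ha1 ha2 hab hac haY (Or.inl rfl) hη
  have pc2 := fun (η : BondConfig V) (hη : η ⊆ (↑DY : Set (Sym2 V))) => pendant_cells (DY := DY) (b := b) (c := c) ha1 ha2 hab hac haY (Or.inr rfl) hη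
  have pcw := fun (η : BondConfig V) (hη : η ⊆ (↑DY : Set (Sym2 V))) => two_pendant_cells (DY := DY) (b := b) (c := c) ha1 ha2 hab hac haY hη
  have iCT := ref_sum_pendant (a := a) h12 w wY q hw hY hY' (fun η hη => (pc1 η hη).1)
  have iCUb := ref_sum_pendant (a := a) h12 w wY q hw hY hY' (fun η hη => (pc1 η hη).2.1)
  have iCUc := ref_sum_pendant (a := a) h12 w wY q hw hY hY' (fun η hη => (pc1 η hη).2.2.1)
  have iCS := ref_sum_pendant (a := a) h12 w wY q hw hY hY' (fun η hη => (pc1 η hη).2.2.2)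
  have iDT := ref_sum_pendant (a := a) h12 w wY q hw hY hY' (fun η hη => (pc2 η hη).1)
  have iDUb := ref_sum_pendant (a := a) h12 w wY q hw hY hY' (fun η hη => (pc2 η hη).2.1)
  have iDUc := ref_sum_pendant (a := a) h12 w wY q hw hY hY' (fun η hη => (pc2 η hη).2.2.1)
  have iDS := ref_sum_pendant (a := a) h12 w wY q hw hY hY' (fun η hη => (pc2 η hη).2.2.2)
  have iAT := ref_sum_two_pendant (h₁ := h₁) (h₂ := h₂) w wY q hw hY hY' (fun η hη => (pcw η hη).1)
  have iAUb := ref_sum_two_pendant (h₁ := h₁) (h₂ := h₂) w wY q hw hY hY' (fun η hη => (pcw η hη).2.1)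
  have iAUc := ref_sum_two_pendant (h₁ := h₁) (h₂ := h₂) w wY q hw hY hY' (fun η hη => (pcw η hη).2.2.1)
  have iAS := ref_sum_two_pendant (h₁ := h₁) (h₂ := h₂) w wY q hw hY hY' (fun η hη => (pcw η hη).2.2.2)
  refine r1_of_blocks h12 ha1 ha2 hab hac hsepD haY hb hc hbc hD w wA wY hq hw hX hX' hY hY' ?_ ?_ ?_ ?_ ?_ ?_
  · rw [iAT, iAS, iAUb, iAUc]; exact mRw
  · rw [iCT, iCS, iCUb, iCUc]; exact mR1
  · rw [iDT, iDS, iDUb, iDUc]; exact mR2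
  · rw [iAT, iCS, iCT, iAS, iAUb, iCUc, iCUb, iAUc]; exact mW0
  · rw [iAT, iDS, iDT, iAS, iAUb, iDUc, iDUb, iAUc]; exact mW1
  · rw [iCT, iDS, iDT, iCS, iCUb, iDUc, iDUb, iCUc]; exact mCR

end Main

end HubPairApex

end Summit.CriticalPhenomena.PercolationContinuityZ3.Theorems
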